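import Literature.NumberTheory.EllipticCurves.LocalKummerMap
import Literature.NumberTheory.EllipticCurves.KummerMap
import Literature.NumberTheory.EllipticCurves.SelmerLocalConditionGoodReductionProofs
import Literature.NumberTheory.EllipticCurves.ArchimedeanLocalCondition
import Literature.NumberTheory.EllipticCurves.DiscreteH1Equiv
import HarnessLib

/-!
# Visible elements of `Ш(E/K)[p]` from a `p`-congruent curve: the dimension count of Cremona–Mazur / Agashe–Stein, also at `p ∣ N`

`Proofs`-style file (theorems only: no definition, no named fact) in topic
`NumberTheory/EllipticCurves`; deliberate dot-notation extensions of Mathlib's `WeierstrassCurve`.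
Written for the cell `b2b-bsdres` (run/shared/lean/b2b/bsd-rank1-residual/), whose HONEST FRAMING
applies to its use there: the goal of that cell is to DELETE the COMBINATION-SHAPED residual classes
for ALL analytic-rank `≤ 1` elliptic curves over `ℚ` — "full BSD formula for every rank `≤ 1` curve
in class C" assembled STRICTLY from published theorems — so that the rank-`≤ 1` remainder becomes
exactly the CONSTRUCTION-SHAPED classes, which are TYPED (missing-input `Prop`s), NOT attempted;
this is not "finishing BSD". The theorem below is the published-inputs engine of ONE per-curve
certificate shape ("`Ш(E)[p] ≠ 0` explained by a congruent curve of larger rank"); it is general and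
cell-independent.

## The theorem (`WeierstrassCurve.exists_sha_ne_zero_of_congr_of_index_lt`)

Let `E = W`, `E' = W'` be elliptic curves over a number field `K`, `p` an ODD prime,
`θ : E'[p] ⥲ E[p]` an isomorphism of `Γ_K`-modules (a "`p`-congruence", Cremona–Mazur 2000 §3),
and `S` a finite set of finite places of `K` containing every place where `E` or `E'` has bad
reduction and every place above `p`. For `v ∈ S` let
`𝓛_v(E') = im (E'(K_v)/pE'(K_v) ↪ H¹(K_v, E'[p]))` be the local Kummer condition
(`WeierstrassCurve.kummerLocalConditionAt`; a finite group of order `#E'(K_v)[p] · #(𝓞_v/p𝓞_v)`,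
Milne *ADT* I Lemma 3.3, tree `natCard_kummerLocalConditionAt_adicCompletion`). **If**
`[E(K) : pE(K)] · ∏_{v ∈ S} #𝓛_v(E') < [E'(K) : pE'(K)]` **then `Ш(E/K)` has a non-zero
element killed by `p`.** Variants (companion file `CongruenceVisibilityLocalFactors.lean`):
`exists_sha_ne_zero_of_congr` (local factors unfolded, with
`∏_{v ∈ S} #(𝓞_v/p) = p^{[K:ℚ]}`), `exists_sha_ne_zero_of_congr_of_rank` (the shape met in
practice: `E(K)` finite of order prime to `p`, `E'(K_v)[p] = 0` for `v ∈ S`,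
`rank E'(K) ≥ [K:ℚ] + 1` — over `ℚ`: a rank-`0` curve with `p ∤ #E(ℚ)` and a `p`-congruent curve of
rank `≥ 2` with no `ℚ_v`-rational `p`-torsion at the bad primes and at `p`).

## Provenance and what is new relative to print

This is the "dimension count" behind B. Mazur's notion of VISIBILITY: J. E. Cremona, B. Mazur,
*Visualizing elements in the Shafarevich–Tate group*, Experiment. Math. 9 (2000) 13–28, §3
("Visibility and congruence moduli": given `ι : E[p] ≅ F[p]`, `F(ℚ)` explains elements of
`Ш(E)`; Table 1: rank-`0` curves `E` with `#Ш_an = p²` and a `p`-congruent rank-`2` curve `F` of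
the same conductor), made rigorous by A. Agashe, W. Stein, *Visibility of Shafarevich–Tate groups
of abelian varieties*, J. Number Theory 97 (2002) 171–185, Thm. 3.1 (with `A = E`, `B = F` inside
`J = (E × F)/Δ`): Lemma 3.6 there is the global step "`B(K)/pB(K) → Vis_J H¹(K, A)` with kernel of
dimension `≤ rank A(K)`", §3.5 the local analysis (Case 1 `v ∣ ∞`: `p` odd; Case 2 `char v ≠ p`:
component groups; Case 3 `char v = p`: "`J` has abelian reduction at `v` (since `p ∤ N`)" and
`e < p − 1`). Agashe–Stein's hypothesis `p ∤ N` (good reduction of `B` at `p`) FAILS for the curves of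
interest to the cell (`p ‖ N`); the present statement replaces the local analysis at the finitely
many places of `S` by the COUNT `∏_{v ∈ S} #𝓛_v(E')` — the classes are only asked to vanish at
`v ∈ S` after passing to a subgroup of index `≤ ∏ #𝓛_v(E')` — and keeps the places `v ∉ S`, where
the local Kummer condition of either curve is "unramified" (B. H. Gross, *Kolyvagin's work on
modular elliptic curves* (1991) (7.1); Milne *ADT* I Prop. 3.8; tree
`selmerLocalKer_eq_unramifiedKer`) and is therefore respected by `θ`. No Jacobian, no multiplicity
one and no Néron-model argument is needed: the input is an abstract `Γ_K`-isomorphism `E'[p] ≅ E[p]`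
(Cremona–Mazur's "`p`-congruence", their conditions (1)–(3), p. 21), which for two newforms of the
same level follows from `a_n(E) ≡ a_n(E') (mod p)` for `n` up to the Sturm bound when `E[p]` is
irreducible (loc. cit., Proposition p. 21 and "Second strategy"). This count is folklore (it is the
trivial half of the comparison of two Selmer structures on the same module, cf. B. Mazur, K. Rubin,
*Ranks of twists of elliptic curves and Hilbert's tenth problem*, Invent. Math. 181 (2010) Lemma 3.2);
we know no numbered printed statement of it allowing `p ∣ N`, which is why it is PROVED here from the
tree's Galois-cohomology library rather than cited.

## Proof (all inputs are theorems of the tree; no named fact is used)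

Let `κ, κ'` be the Kummer maps of `E, E'` (`kummerMapTorsion`, kernel `pE(K)`, resp. `pE'(K)`:
`kummerMapTorsion_ker`; image inside the finite Selmer group: `finite_selmerGroup_holds`), `θ_*` the
transport `H¹(K, E'[p]) ⥲ H¹(K, E[p])` (`h1Equiv`), `f = (H¹(K, E[p]) → H¹(K, E)) ∘ θ_* ∘ κ'` and,
for `v ∈ S`, `g_v = res_v ∘ κ' : E'(K) → H¹(K_v, E'[p])`, with image in `𝓛_v(E')`
(`res_kummerMapTorsion_mem_kummerLocalConditionAt`). Put `B = ⋂_{v ∈ S} ker g_v`, `C = ker f`.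
Then `[E'(K) : B] ≤ ∏ #𝓛_v(E')` (`AddSubgroup.index_iInf_le`), `pE'(K) ≤ C` and
`[C : pE'(K)] ≤ #im κ = [E(K) : pE(K)]` (a class of `H¹(K, E[p])` dying in `H¹(K, E)` is a Kummer
class: `mem_range_kummerMapTorsion_of_torsionH1ToH1_eq_zero`; `θ_*` is injective), so the
hypothesis forces `B ⊄ C`. For `P ∈ B \ C` the class `c = f(P) ≠ 0` satisfies `pc = f(pP) = 0` and
lies in `Ш(E/K)`: at `v ∈ S` because `res_v κ'(P) = 0` transports to the local Selmer condition
of `E` (`h1Equiv_mem_selmerLocalKer_of_res_eq_zero`, `torsionH1ToH1_mem_localRestrictionKer`); at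
`v ∉ S` because `κ'(P)` is unramified at `v` (good reduction of `E'`, `v ∤ p`), unramifiedness
passes through `θ` (`mem_unramifiedKer_iff_h1Equiv_mem`) and unramified classes satisfy the local
condition of `E` (good reduction of `E`, `v ∤ p`; `unramifiedKer_le_selmerLocalKer`); at the
infinite places because `2c ↦ 0` (`two_nsmul_mem_localRestrictionKer_infinitePlace`) and `pc = 0`
with `p` odd. (The local factors `#𝓛_v = #E'(K_v)[p] · #(𝓞_v/p)`, `∏_{v ∣ p} #(𝓞_v/p) = p^{[K:ℚ]}`
and the index bounds `[A : pA] = 1`, `p^{rank} ≤ [E(K) : pE(K)]` are in the companion file.) Universe: `K : Type` (the archimedean lemma of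
`ArchimedeanLocalCondition` is stated in `Type`).

## References

* [CremonaMazur2000] J. E. Cremona, B. Mazur, *Visualizing elements in the Shafarevich–Tate
  group*, Experiment. Math. 9 (2000) 13–28, §3 (pp. 19–22) (held: doi 10.1080/10586458.2000.10504633).
* [AgasheStein2002] A. Agashe, W. Stein, *Visibility of Shafarevich–Tate groups of abelian
  varieties*, J. Number Theory 97 (2002) 171–185, Lemma 3.6, Thm. 3.1 and §3.5 (held: doi
  10.1006/jnth.2002.2810).
* [GrossLMS1991] B. H. Gross, *Kolyvagin's work on modular elliptic curves*, LMS LN 153 (1991), §7 (7.1).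
* [MilneADT2006] J. S. Milne, *Arithmetic Duality Theorems*, 2nd ed., I Lemma 3.3, Prop. 3.8, §6.
* [SilvermanAEC2009] J. H. Silverman, *The Arithmetic of Elliptic Curves*, 2nd ed., VIII.§2, X.§4.
* B. Mazur, K. Rubin, *Ranks of twists of elliptic curves and Hilbert's tenth problem*, Invent.
  Math. 181 (2010), §§2–3 (comparison of Selmer structures on `E[2]`).
-/

noncomputable section

open scoped Classical

universe u

namespace WeierstrassCurve

open Literature.NumberTheory.EllipticCurves Literature.NumberTheory.GaloisRepresentations Field
open NumberField IsDedekindDomain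

section Transport

variable {K : Type u} [Field K] (W W' : WeierstrassCurve K) {n : ℤ}
variable (θ : geomTorsion W' n ≃+ geomTorsion W n)
  (hθ : ∀ (σ : absoluteGaloisGroup K) (P : geomTorsion W' n), θ (σ • P) = σ • θ P)

/-- `h1Equiv θ` on the class of a continuous cocycle `φ : Γ_K → E'[n]` is the class of `θ ∘ φ`.
[folklore] -/
theorem h1Equiv_oneCocycleClass
    (φ : contOneCocycles (discreteTopRep (absoluteGaloisGroup K) (geomTorsion W' n))) :
    h1Equiv θ hθ (oneCocycleClass _ φ) =
      oneCocycleClass (discreteTopRep (absoluteGaloisGroup K) (geomTorsion W n))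
        (contOneCocycles.pullback (ContinuousMonoidHom.id (absoluteGaloisGroup K))
          (resHomOfEquivariant (ContinuousMonoidHom.id (absoluteGaloisGroup K))
            (θ : geomTorsion W' n →+ geomTorsion W n) hθ) φ) :=
  map_oneCocycleClass _ _ _ φ

/-- Pointwise form: a cocycle of `h1Equiv θ [φ]` is `σ ↦ θ (φ σ)`. [folklore] -/
theorem h1Equiv_oneCocycleClass_apply
    (φ : contOneCocycles (discreteTopRep (absoluteGaloisGroup K) (geomTorsion W' n)))
    (σ : absoluteGaloisGroup K) :
    (contOneCocycles.pullback (ContinuousMonoidHom.id (absoluteGaloisGroup K))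
          (resHomOfEquivariant (ContinuousMonoidHom.id (absoluteGaloisGroup K))
            (θ : geomTorsion W' n →+ geomTorsion W n) hθ) φ).1 σ = θ (φ.1 σ) :=
  rfl

/-- **Transport of "unramified at `𝔓`" along a `Γ_K`-isomorphism `E'[n] ≃ E[n]`.** [folklore] -/
theorem mem_unramifiedKer_iff_h1Equiv_mem (𝔓 : Ideal (absIntegers (𝓞 K) K))
    (c : galH1Torsion W' n) :
    c ∈ unramifiedKer (geomTorsion W' n) 𝔓 ↔
      h1Equiv θ hθ c ∈ unramifiedKer (geomTorsion W n) 𝔓 := by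
  obtain ⟨φ, rfl⟩ :=
    oneCocycleClass_surjective (discreteTopRep (absoluteGaloisGroup K) (geomTorsion W' n)) c
  rw [h1Equiv_oneCocycleClass, unramifiedKer, unramifiedKer,
    oneCocycleClass_mem_subgroupResKer_iff, oneCocycleClass_mem_subgroupResKer_iff]
  constructor
  · rintro ⟨a, ha⟩
    refine ⟨θ a, fun σ ↦ ?_⟩
    rw [h1Equiv_oneCocycleClass_apply, ha σ, map_sub, hθ]
  · rintro ⟨b, hb⟩
    refine ⟨θ.symm b, fun σ ↦ θ.injective ?_⟩
    rw [← h1Equiv_oneCocycleClass_apply W W' θ hθ φ, hb σ, map_sub, hθ, AddEquiv.apply_symm_apply]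

variable (E : Type u) [Field E] [Algebra K E]

/-- **If a class of `H¹(K, E'[n])` restricts to zero in `H¹(K_v, E'[n])`, its transport to
`H¹(K, E[n])` satisfies the local Selmer condition of `E` at `K_v`** (it even restricts to zero in
`H¹(K_v, E[n])`). [folklore] -/
theorem h1Equiv_mem_selmerLocalKer_of_res_eq_zero (c : galH1Torsion W' n)
    (hc : galoisCohomology.res (W'.torsionGaloisModule n) E 1 c = 0) :
    h1Equiv θ hθ c ∈ selmerLocalKer W E n := by
  obtain ⟨φ, rfl⟩ :=
    oneCocycleClass_surjective (discreteTopRep (absoluteGaloisGroup K) (geomTorsion W' n)) c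
  rw [res_torsionGaloisModule_oneCocycleClass] at hc
  obtain ⟨a, ha⟩ := (oneCocycleClass_eq_zero_iff _ _).mp hc
  rw [h1Equiv_oneCocycleClass, selmerLocalKer, oneCocycleClass_mem_resKer_iff]
  refine ⟨pointsMap W E (θ a : geomTorsion W n), fun σ ↦ ?_⟩
  have h1 : φ.1 (resGal (K := K) E σ) = resGal (K := K) E σ • a - a := ha σ
  rw [h1Equiv_oneCocycleClass_apply]
  change pointsMap W E ((θ (φ.1 (resGal (K := K) E σ)) : geomTorsion W n) : geomPoints W) = _
  rw [h1, map_sub, hθ, AddSubgroupClass.coe_sub, map_sub,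
    Literature.NumberTheory.EllipticCurves.AddSubgroup.torsionBy.coe_smul, pointsMap_smul]

/-- **The local Selmer condition passes from `H¹(K, E[n])` to `H¹(K, E)`**: if `c` dies in
`H¹(K_v, E)` (as a class with coefficients `E[n]`), so does its image under
`H¹(K, E[n]) → H¹(K, E)`. [folklore] -/
theorem torsionH1ToH1_mem_localRestrictionKer {c : galH1Torsion W n}
    (hc : c ∈ selmerLocalKer W E n) : torsionH1ToH1 W n c ∈ W.localRestrictionKer E := by
  obtain ⟨φ, rfl⟩ :=
    oneCocycleClass_surjective (discreteTopRep (absoluteGaloisGroup K) (geomTorsion W n)) c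
  rw [selmerLocalKer, oneCocycleClass_mem_resKer_iff] at hc
  obtain ⟨a, ha⟩ := hc
  unfold torsionH1ToH1
  simp only [LinearMap.toAddMonoidHom_coe, ContinuousLinearMap.coe_coe]
  rw [map_oneCocycleClass, localRestrictionKer, oneCocycleClass_mem_resKer_iff]
  exact ⟨a, fun σ ↦ ha σ⟩

/-- The restriction to `Γ_{K_v}` of a global Kummer class of `E'` lies in the local Kummer condition
`𝓛_v(E')`. [folklore] -/
theorem res_kummerMapTorsion_mem_kummerLocalConditionAt
    (hdiv : ∀ P : geomPoints W', ∃ Q : geomPoints W', n • Q = P) (P : W'.toAffine.Point) :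
    galoisCohomology.res (W'.torsionGaloisModule n) E 1 (kummerMapTorsion W' n hdiv P) ∈
      W'.kummerLocalConditionAt n E := by
  have h := kummerMapTorsion_mem_selmerLocalKer W' n hdiv E P
  rw [← comap_res_kummerLocalConditionAt] at h
  exact h

end Transport

section Main

variable {K : Type} [Field K] [NumberField K] (W W' : WeierstrassCurve K) [W.IsElliptic]
  [W'.IsElliptic] {p : ℕ} [Fact p.Prime]

/-- **Visible elements of `Ш(E/K)[p]` explained by a `p`-congruent curve (the dimension count of
Cremona–Mazur / Agashe–Stein, valid also when `p` divides the conductor).** Let `E = W`,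
`E' = W'` be elliptic curves over a number field `K`, `p` an odd prime, `θ : E'[p] ≃ E[p]` a
`Γ_K`-equivariant isomorphism, and `S` a finite set of finite places containing every place of bad
reduction of `E` or `E'` and every place above `p`. If
`[E(K) : pE(K)] · ∏_{v ∈ S} #𝓛_v(E') < [E'(K) : pE'(K)]`, where
`𝓛_v(E') = im (E'(K_v)/p → H¹(K_v, E'[p]))` is the local Kummer condition (of order
`#E'(K_v)[p] · #(𝓞_v/p)`, `natCard_kummerLocalConditionAt_adicCompletion`), then `Ш(E/K)` has a
non-zero element killed by `p`. Proof: see the module docstring (Kummer maps, transport along `θ`, the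
unramified local condition at `v ∉ S`, the count at `v ∈ S`, oddness of `p` at `v ∣ ∞`). The
hypothesis `p ∤ N` of Agashe–Stein's Thm. 3.1 is NOT needed: places above `p` may lie in `S`.
[cite: CremonaMazur2000, §3 pp. 19–22] [cite: AgasheStein2002, Lemma 3.6 and Thm. 3.1] -/
theorem exists_sha_ne_zero_of_congr_of_index_lt (hp2 : p ≠ 2)
    (θ : geomTorsion W' (p : ℤ) ≃+ geomTorsion W (p : ℤ))
    (hθ : ∀ (σ : absoluteGaloisGroup K) (P : geomTorsion W' (p : ℤ)), θ (σ • P) = σ • θ P)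
    (S : Finset (HeightOneSpectrum (𝓞 K)))
    (hS : ∀ v : HeightOneSpectrum (𝓞 K), v ∉ S →
      W.HasGoodReductionAt v ∧ W'.HasGoodReductionAt v ∧ (p : 𝓞 K) ∉ v.asIdeal)
    (hlt : (zsmulAddGroupHom (p : ℤ) : W.toAffine.Point →+ W.toAffine.Point).range.index *
        ∏ v ∈ S, Nat.card (W'.kummerLocalConditionAt (p : ℤ) (v.adicCompletion K)) <
      (zsmulAddGroupHom (p : ℤ) : W'.toAffine.Point →+ W'.toAffine.Point).range.index) :
    ∃ c : W.sha, c ≠ 0 ∧ p • c = 0 := by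
  have hp : p.Prime := Fact.out
  have hn : (p : ℤ) ≠ 0 := by exact_mod_cast hp.ne_zero
  have hdiv : ∀ P : geomPoints W, ∃ Q : geomPoints W, (p : ℤ) • Q = P :=
    W.zsmul_geomPoints_surjective_holds hn
  have hdiv' : ∀ P : geomPoints W', ∃ Q : geomPoints W', (p : ℤ) • Q = P :=
    W'.zsmul_geomPoints_surjective_holds hn
  -- the Kummer maps of `E` and `E'`, the visibility map `f : E'(K) → H¹(K, E)` and the local maps
  set κ := kummerMapTorsion W (p : ℤ) hdiv with hκ
  set κ' := kummerMapTorsion W' (p : ℤ) hdiv' with hκ'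
  set f : W'.toAffine.Point →+ W.galH1 :=
    (torsionH1ToH1 W (p : ℤ)).comp ((h1Equiv θ hθ).toAddMonoidHom.comp κ') with hf
  have hf_apply : ∀ P, f P = torsionH1ToH1 W (p : ℤ) (h1Equiv θ hθ (κ' P)) := fun P ↦ rfl
  set g : ∀ v : HeightOneSpectrum (𝓞 K), W'.toAffine.Point →+
      galoisCohomology (GaloisRep.restrictField (v.adicCompletion K)
        (W'.torsionGaloisModule (p : ℤ))) 1 :=
    fun v ↦ (galoisCohomology.res (W'.torsionGaloisModule (p : ℤ)) (v.adicCompletion K) 1).comp κ'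
    with hg
  have hg_apply : ∀ v P, g v P =
      galoisCohomology.res (W'.torsionGaloisModule (p : ℤ)) (v.adicCompletion K) 1 (κ' P) :=
    fun v P ↦ rfl
  set B : AddSubgroup W'.toAffine.Point := ⨅ v : S, (g v).ker with hB
  set C : AddSubgroup W'.toAffine.Point := f.ker with hC
  -- the Kummer image of `E(K)` is finite, of order `[E(K) : pE(K)]`
  have hκle : κ.range ≤ W.selmerGroup (p : ℤ) := by
    rintro _ ⟨P, rfl⟩
    exact (mem_selmerGroup_iff W _ _).mpr
      ⟨fun v ↦ kummerMapTorsion_mem_selmerLocalKer W _ hdiv _ P,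
        fun w ↦ kummerMapTorsion_mem_selmerLocalKer W _ hdiv _ P⟩
  haveI hSelfin : Finite (W.selmerGroup (p : ℤ)) := W.finite_selmerGroup_holds hn
  haveI hκfin : Finite κ.range := Finite.of_injective _ (AddSubgroup.inclusion_injective hκle)
  have hidxE : (zsmulAddGroupHom (p : ℤ) : W.toAffine.Point →+ W.toAffine.Point).range.index =
      Nat.card κ.range := by
    rw [← kummerMapTorsion_ker W (p : ℤ) hdiv, AddSubgroup.index_ker]
  -- (1) `[E'(K) : B] ≤ ∏ #𝓛_v` and `B` has finite index
  have hgrange : ∀ v : HeightOneSpectrum (𝓞 K),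
      (g v).range ≤ W'.kummerLocalConditionAt (p : ℤ) (v.adicCompletion K) := by
    rintro v _ ⟨P, rfl⟩
    rw [hg_apply]
    exact res_kummerMapTorsion_mem_kummerLocalConditionAt W' _ hdiv' P
  have hgker : ∀ v : HeightOneSpectrum (𝓞 K),
      (g v).ker.index ≤ Nat.card (W'.kummerLocalConditionAt (p : ℤ) (v.adicCompletion K)) ∧
        (g v).ker.index ≠ 0 := by
    intro v
    haveI : Finite (W'.kummerLocalConditionAt (p : ℤ) (v.adicCompletion K)) :=
      W'.finite_kummerLocalConditionAt_adicCompletion v hp.ne_zero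
    haveI : Finite (g v).range :=
      Finite.of_injective _ (AddSubgroup.inclusion_injective (hgrange v))
    rw [AddSubgroup.index_ker]
    exact ⟨Nat.card_le_card_of_injective _ (AddSubgroup.inclusion_injective (hgrange v)),
      Nat.card_pos.ne'⟩
  have hBle : B.index ≤ ∏ v ∈ S, Nat.card (W'.kummerLocalConditionAt (p : ℤ) (v.adicCompletion K)) := by
    refine (AddSubgroup.index_iInf_le _).trans ?_
    rw [← Finset.prod_coe_sort S]
    exact Finset.prod_le_prod' fun v _ ↦ (hgker v).1
  have hBne : B.index ≠ 0 := AddSubgroup.index_iInf_ne_zero fun v ↦ (hgker v).2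
  -- (2) `pE'(K) ≤ C` and `[C : pE'(K)] ≤ [E(K) : pE(K)]`
  have hpC : (zsmulAddGroupHom (p : ℤ) : W'.toAffine.Point →+ W'.toAffine.Point).range ≤ C := by
    intro P hP
    rw [← kummerMapTorsion_ker W' (p : ℤ) hdiv'] at hP
    rw [hC, AddMonoidHom.mem_ker, hf_apply, show κ' P = 0 from hP, map_zero, map_zero]
  have hrel : (zsmulAddGroupHom (p : ℤ) : W'.toAffine.Point →+ W'.toAffine.Point).range.relIndex C ≤
      Nat.card κ.range := by
    -- `ψ : C → H¹(K, E[p])`, `P ↦ θ_* κ'(P)`, has kernel `pE'(K)` and image inside `im κ`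
    set ψ : C →+ galH1Torsion W (p : ℤ) :=
      ((h1Equiv θ hθ).toAddMonoidHom.comp κ').comp C.subtype with hψ
    have hψ_apply : ∀ P : C, ψ P = h1Equiv θ hθ (κ' P) := fun P ↦ rfl
    have hψker : ((zsmulAddGroupHom (p : ℤ) :
        W'.toAffine.Point →+ W'.toAffine.Point).range).addSubgroupOf C = ψ.ker := by
      ext P
      rw [AddSubgroup.mem_addSubgroupOf, ← kummerMapTorsion_ker W' (p : ℤ) hdiv',
        AddMonoidHom.mem_ker, AddMonoidHom.mem_ker, hψ_apply, map_eq_zero_iff _ (h1Equiv θ hθ).injective]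
    have hψle : ψ.range ≤ κ.range := by
      rintro _ ⟨P, rfl⟩
      rw [hψ_apply]
      have hP : f P = 0 := P.2
      rw [hf_apply] at hP
      exact mem_range_kummerMapTorsion_of_torsionH1ToH1_eq_zero W (p : ℤ) hdiv _ hP
    rw [AddSubgroup.relIndex, hψker, AddSubgroup.index_ker]
    exact Nat.card_le_card_of_injective _ (AddSubgroup.inclusion_injective hψle)
  -- (3) hence `B ⊄ C`
  have hBC : ¬ B ≤ C := by
    intro hle
    have h1 : C.index ≤ B.index :=
      Nat.le_of_dvd (Nat.pos_of_ne_zero hBne) (AddSubgroup.index_dvd_of_le hle)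
    have h2 := AddSubgroup.relIndex_mul_index hpC
    have h3 : (zsmulAddGroupHom (p : ℤ) : W'.toAffine.Point →+ W'.toAffine.Point).range.index ≤
        (zsmulAddGroupHom (p : ℤ) : W.toAffine.Point →+ W.toAffine.Point).range.index *
          ∏ v ∈ S, Nat.card (W'.kummerLocalConditionAt (p : ℤ) (v.adicCompletion K)) := by
      rw [← h2, hidxE]
      exact Nat.mul_le_mul hrel (h1.trans hBle)
    exact absurd hlt (not_lt.mpr h3)
  obtain ⟨P, hPB, hPC⟩ := SetLike.not_le_iff_exists.mp hBC
  -- (4) the class `c = f(P)` is a non-zero element of `Ш(E/K)[p]`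
  set c := f P with hc
  have hpc : p • c = 0 := by
    rw [hc, ← map_nsmul, ← natCast_zsmul]
    exact hpC ⟨P, rfl⟩
  have hsha : c ∈ W.sha := by
    rw [mem_sha_iff]
    refine ⟨fun v ↦ ?_, fun w ↦ ?_⟩
    · rw [hc, hf_apply]
      apply torsionH1ToH1_mem_localRestrictionKer
      by_cases hv : v ∈ S
      · -- `v ∈ S`: `P ∈ B` means `res_v κ'(P) = 0`
        apply h1Equiv_mem_selmerLocalKer_of_res_eq_zero
        rw [← hg_apply, ← AddMonoidHom.mem_ker]
        rw [hB, AddSubgroup.mem_iInf] at hPB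
        exact hPB ⟨v, hv⟩
      · -- `v ∉ S`: good reduction of both curves and `v ∤ p`; Kummer classes are unramified
        obtain ⟨hgood, hgood', hpv⟩ := hS v hv
        have hpv' : ((p : ℤ) : 𝓞 K) ∉ v.asIdeal := by rwa [Int.cast_natCast]
        obtain ⟨𝔓, h𝔓⟩ := v.primesAbove_nonempty
        refine W.unramifiedKer_le_selmerLocalKer hgood hpv' h𝔓 ?_
        rw [← mem_unramifiedKer_iff_h1Equiv_mem, ← W'.selmerLocalKer_eq_unramifiedKer hgood' hpv' h𝔓]
        exact kummerMapTorsion_mem_selmerLocalKer W' _ hdiv' _ P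
    · -- infinite places: `2c ↦ 0` and `pc = 0` with `p` odd
      obtain ⟨k, hk⟩ := hp.odd_of_ne_two hp2
      have h2 := two_nsmul_mem_localRestrictionKer_infinitePlace W w c
      have hck : c = p • c - k • (2 • c) := by
        rw [hk, add_nsmul, one_nsmul, mul_nsmul, add_sub_cancel_left]
      rw [hck, hpc, zero_sub]
      exact neg_mem (AddSubgroup.nsmul_mem _ h2 k)
  refine ⟨⟨c, hsha⟩, fun h ↦ hPC ?_, Subtype.ext hpc⟩
  rw [hC, AddMonoidHom.mem_ker, ← hc]
  exact congrArg Subtype.val h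

end Main

end WeierstrassCurve

end
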